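import Mathlib
import HarnessLib
import Summits.ValiantsHypothesis.ValiantsHypothesis.Theorems.EquivariantDialLayers
import Literature.AlgebraicGeometry.HyperbolicPolynomials.ElementarySymmetricCone

/-!
# EquivariantDialLayersToy — the diagonal shadow of the leaf `R^lay` is polynomial

Census cell `A^lay` (`EqHardLayeredBiPerm`, W36) has the typed leaf
`R^lay = IdealWidthSuperpoly biPermSubst`: superpolynomial growth of the `𝔖_m × 𝔖_m`-equivariant
IDEAL WIDTH `idealWidth (biPermSubst m) per_m d` (least dimension of a `Γ`-stable space of degree-`d`
forms whose ideal contains `per_m`, `Theorems.EquivariantDialLayers`).  The obvious `Γ`-stable cut of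
`per_m` in degree `d` is the span of all `d × d` subpermanents (Laplace), of dimension `C(m,d)²`, and the
obvious cut of its DIAGONAL SHADOW `e_m(y) = y₁ ⋯ y_m` (restrict `x` to diagonal matrices; the window
group restricts to the symmetric group permuting the `y_i`) is the span of the squarefree monomials
`y_S`, `|S| = d`, of dimension `C(m,d)` — both exponential at `d = m/2`.

THIS FILE (kernel, sorry-free) shows that on the diagonal shadow the exponential is an artefact of the
construction: for every finite index type `σ` (`m = |σ|`), every field `k` of characteristic zero, every
subgroup `Γ ≤ GL(σ, k)` consisting of permutation matrices and every `d ≤ m`,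

  `HasIdealWidthLE Γ (∏ i, X i) d (m · (d + 1) + 1)`                    (`hasIdealWidthLE_prod_X`)

witnessed by the `Γ`-stable set `{X_j^{d-a} · e_a : j ∈ σ, a ≤ d} ∪ {e_d}` (`toySet`), via NEWTON'S
IDENTITIES (`MvPolynomial.mul_esymm_eq_sum`): `n · e_n = Σ_{i ≥ 1} (−1)^{i−1} e_{n−i} p_i`, and for
`a = n − i < d < n` one has `e_a p_i = Σ_j (X_j^{d−a} e_a) · X_j^{i−d+a}` (`esymm_mem_toyIdeal`).  Hence the
toy analogue of `R^lay` is FALSE (`not_toyIdealWidthSuperpoly`): the symmetric-group-equivariant ideal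
width of `e_m` is `≤ m(d+1)+1` at every cut, although every TRANSFER-type lower bound for `R^lay`
(restriction of a `biPermSubst`-stable cut of `per_m` to diagonal, or to rank-one, matrices) lands in
this toy.  Consequence for the census (lens 1, g15): lower bounds for `R^lay` cannot come from diagonal /
rank-one restriction; they must use the bipartite (row AND column) structure of the non-matching monomials.
No item is closed; this is a calibration kernel `--supports` cell A (item 23702's census cell family).
-/

namespace Summit.ValiantsHypothesis.ValiantsHypothesis.Theorems.EquivariantDialLayersToy

open MvPolynomial Finset Literature.Computability.AlgebraicComplexity
open Summit.ValiantsHypothesis.ValiantsHypothesis.Theorems.EquivariantDialLayers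

noncomputable section

variable {σ : Type*} [Fintype σ] [DecidableEq σ] {k : Type*} [Field k]

/-! ## §1 The generating set `{X_j^{d-a} e_a} ∪ {e_d}` -/

section ToyCut

/- The cut is a `Finset` of polynomials; its construction uses (classical) decidable equality of
polynomials, supplied by `classical` in §3. -/
variable [DecidableEq (MvPolynomial σ k)]

/-- The generator `X_j^{d-a} · e_a(X)` indexed by `(j, a)`. -/
def toyGen (d : ℕ) (ja : σ × ℕ) : MvPolynomial σ k :=
  X ja.1 ^ (d - ja.2) * esymm σ k ja.2

/-- The toy cut in degree `d`: `{X_j^{d-a} · e_a : j ∈ σ, a ≤ d} ∪ {e_d}`. -/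
def toySet (d : ℕ) : Finset (MvPolynomial σ k) :=
  insert (esymm σ k d) ((univ ×ˢ range (d + 1)).image (toyGen (k := k) d))

omit [DecidableEq σ] in
/-- `e_d` belongs to the toy cut. -/
theorem esymm_mem_toySet (d : ℕ) : esymm σ k d ∈ toySet (σ := σ) (k := k) d := by
  unfold toySet
  exact mem_insert_self _ _

omit [DecidableEq σ] in
/-- `X_j^{d-a} e_a` belongs to the toy cut for `a ≤ d`. -/
theorem toyGen_mem_toySet {d a : ℕ} (j : σ) (ha : a ≤ d) :
    X j ^ (d - a) * esymm σ k a ∈ toySet (σ := σ) (k := k) d := by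
  unfold toySet
  refine mem_insert_of_mem (mem_image.2 ⟨(j, a), ?_, rfl⟩)
  exact mem_product.2 ⟨mem_univ _, mem_range.2 (Nat.lt_succ_of_le ha)⟩

omit [DecidableEq σ] in
/-- The toy cut has at most `|σ| · (d + 1) + 1` elements. -/
theorem card_toySet_le (d : ℕ) :
    (toySet (σ := σ) (k := k) d).card ≤ Fintype.card σ * (d + 1) + 1 := by
  unfold toySet
  refine (card_insert_le _ _).trans ?_
  refine Nat.add_le_add_right (card_image_le.trans ?_) 1
  rw [card_product, card_univ, card_range]

omit [DecidableEq σ] in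
/-- Every element of the toy cut is a form of degree `d`. -/
theorem isHomogeneous_of_mem_toySet {d : ℕ} {p : MvPolynomial σ k}
    (hp : p ∈ toySet (σ := σ) (k := k) d) : p.IsHomogeneous d := by
  unfold toySet at hp
  rcases mem_insert.1 hp with rfl | hp
  · exact Literature.AlgebraicGeometry.HyperbolicPolynomials.esymm_isHomogeneous k d
  · obtain ⟨⟨j, a⟩, hja, rfl⟩ := mem_image.1 hp
    have ha : a ≤ d := Nat.le_of_lt_succ (mem_range.1 (mem_product.1 hja).2)
    have h := (isHomogeneous_X_pow (R := k) j (d - a)).mul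
      (Literature.AlgebraicGeometry.HyperbolicPolynomials.esymm_isHomogeneous (σ := σ) k a)
    simpa [toyGen, Nat.sub_add_cancel ha] using h

omit [DecidableEq σ] in
/-- The toy cut is stable under renaming the variables by a permutation (its span is a permutation
module: `e_a` is symmetric and the `X_j` are permuted). -/
theorem rename_mem_span_toySet {d : ℕ} (P : Equiv.Perm σ) {p : MvPolynomial σ k}
    (hp : p ∈ toySet (σ := σ) (k := k) d) :
    rename P p ∈ Submodule.span k (toySet (σ := σ) (k := k) d : Set (MvPolynomial σ k)) := by
  refine Submodule.subset_span ?_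
  unfold toySet at hp
  rcases mem_insert.1 hp with rfl | hp
  · rw [rename_esymm]
    exact esymm_mem_toySet d
  · obtain ⟨⟨j, a⟩, hja, rfl⟩ := mem_image.1 hp
    have ha : a ≤ d := Nat.le_of_lt_succ (mem_range.1 (mem_product.1 hja).2)
    have : rename P (toyGen (k := k) d (j, a)) = X (P j) ^ (d - a) * esymm σ k a := by
      simp only [toyGen, map_mul, map_pow, rename_X, rename_esymm]
    simpa only [this, Finset.mem_coe] using toyGen_mem_toySet (k := k) (P j) ha

/-! ## §2 Newton's identities put every `e_n`, `n ≥ d`, in the toy ideal -/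

omit [DecidableEq σ] in
/-- For `a < d` and `d - a ≤ i`: `e_a · p_i = Σ_j (X_j^{d-a} e_a) · X_j^{i-(d-a)}` lies in the toy ideal. -/
theorem esymm_mul_psum_mem_toyIdeal {d a i : ℕ} (ha : a < d) (hi : d - a ≤ i) :
    esymm σ k a * psum σ k i ∈ Ideal.span (toySet (σ := σ) (k := k) d : Set (MvPolynomial σ k)) := by
  obtain ⟨e, he⟩ : ∃ e, i = (d - a) + e := ⟨i - (d - a), by omega⟩
  rw [MvPolynomial.psum, mul_sum]
  refine Ideal.sum_mem _ fun j _ => ?_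
  have hj : esymm σ k a * X j ^ i = (X j ^ (d - a) * esymm σ k a) * X j ^ e := by
    rw [he, pow_add]; ring
  rw [hj]
  exact Ideal.mul_mem_right _ _ (Ideal.subset_span (toyGen_mem_toySet j ha.le))

variable [CharZero k]

omit [DecidableEq σ] in
/-- Every elementary symmetric polynomial `e_n` with `n ≥ d` lies in the ideal of the toy cut
(induction on `n` via Newton's identities; characteristic zero divides by `n`). -/
theorem esymm_mem_toyIdeal (d : ℕ) :
    ∀ n, d ≤ n → esymm σ k n ∈ Ideal.span (toySet (σ := σ) (k := k) d : Set (MvPolynomial σ k)) := by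
  intro n
  refine Nat.strong_induction_on n fun n ih hdn => ?_
  set I : Ideal (MvPolynomial σ k) := Ideal.span (toySet (σ := σ) (k := k) d : Set (MvPolynomial σ k))
  rcases hdn.eq_or_lt with rfl | hlt
  · exact Ideal.subset_span (esymm_mem_toySet d)
  -- Newton: `n · e_n = (−1)^{n+1} Σ_{a₁ + a₂ = n, a₁ < n} (−1)^{a₁} e_{a₁} p_{a₂}`.
  have hN : (n : MvPolynomial σ k) * esymm σ k n ∈ I := by
    rw [MvPolynomial.mul_esymm_eq_sum σ k n]
    refine Ideal.mul_mem_left _ _ (Ideal.sum_mem _ fun a ha => ?_)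
    obtain ⟨ha, han⟩ := mem_filter.1 ha
    have hsum : a.1 + a.2 = n := mem_antidiagonal.1 ha
    by_cases hda : d ≤ a.1
    · exact Ideal.mul_mem_right _ _ (Ideal.mul_mem_left _ _ (ih a.1 han hda))
    · rw [mul_assoc]
      exact Ideal.mul_mem_left _ _
        (esymm_mul_psum_mem_toyIdeal (not_le.1 hda) (by omega))
  have hn0 : (n : k) ≠ 0 := by exact_mod_cast (show n ≠ 0 by omega)
  have hrew : esymm σ k n = C ((n : k)⁻¹) * ((n : MvPolynomial σ k) * esymm σ k n) := by
    rw [show (n : MvPolynomial σ k) = C (n : k) from (map_natCast C n).symm, ← mul_assoc, ← C_mul,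
      inv_mul_cancel₀ hn0, C_1, one_mul]
  rw [hrew]
  exact Ideal.mul_mem_left _ _ hN

end ToyCut

omit [DecidableEq σ] in
/-- `∏_i X_i = e_{|σ|}`. -/
theorem prod_X_eq_esymm_card : (∏ i, X i : MvPolynomial σ k) = esymm σ k (Fintype.card σ) := by
  rw [MvPolynomial.esymm, ← card_univ, powersetCard_self, sum_singleton]

/-! ## §3 The theorem: polynomial equivariant ideal width of `∏ X_i` under permutation groups -/

section Main

variable [CharZero k]

/-- **Toy theorem.**  For every subgroup `Γ ≤ GL(σ)` of permutation matrices and every `d ≤ |σ|`, the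
product of all the variables is cut in degree `d` by a `Γ`-stable set of at most `|σ|(d+1)+1` forms:
`HasIdealWidthLE Γ (∏ X_i) d (|σ|(d+1)+1)`. -/
theorem hasIdealWidthLE_prod_X (Γ : Subgroup (GL σ k))
    (hΓ : ∀ γ ∈ Γ, ∃ P : Equiv.Perm σ, (γ : Matrix σ σ k) = P.permMatrix k) {d : ℕ}
    (hd : d ≤ Fintype.card σ) :
    HasIdealWidthLE Γ (∏ i, X i : MvPolynomial σ k) d (Fintype.card σ * (d + 1) + 1) := by
  classical
  refine ⟨toySet d, card_toySet_le d, fun p hp => isHomogeneous_of_mem_toySet hp,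
    fun γ hγ p hp => ?_, ?_⟩
  · obtain ⟨P, hP⟩ := hΓ γ hγ
    rw [hP, linSubst_permMatrix]
    exact rename_mem_span_toySet P.symm hp
  · rw [prod_X_eq_esymm_card]
    exact esymm_mem_toyIdeal d _ hd

/-- Hence the equivariant ideal width of `∏ X_i` under a permutation group is at most `|σ|(d+1)+1`. -/
theorem idealWidth_prod_X_le (Γ : Subgroup (GL σ k))
    (hΓ : ∀ γ ∈ Γ, ∃ P : Equiv.Perm σ, (γ : Matrix σ σ k) = P.permMatrix k) {d : ℕ}
    (hd : d ≤ Fintype.card σ) :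
    idealWidth Γ (∏ i, X i : MvPolynomial σ k) d ≤ Fintype.card σ * (d + 1) + 1 :=
  idealWidth_le (hasIdealWidthLE_prod_X Γ hΓ hd)

end Main

/-! ## §4 The diagonal shadow of the window: the toy analogue of `R^lay` is false -/

/-- The **permutation substitutions** of the variables: the subgroup of `GL(σ, k)` of permutation
matrices (the diagonal shadow of the window group `biPermSubst`: restricted to diagonal matrices
`x = diag(y)`, the bi-permutations `(π, π)` act on `y` by permutation matrices). -/
def permSubst (σ k : Type*) [Fintype σ] [DecidableEq σ] [Field k] : Subgroup (GL σ k) :=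
  (Matrix.permMatrixHom (n := σ) (R := k)).toHomUnits.range

/-- Every element of `permSubst` is a permutation matrix. -/
theorem exists_permMatrix_of_mem_permSubst {γ : GL σ k} (hγ : γ ∈ permSubst σ k) :
    ∃ P : Equiv.Perm σ, (γ : Matrix σ σ k) = P.permMatrix k := by
  obtain ⟨P, rfl⟩ := hγ
  exact ⟨P⁻¹, by rw [MonoidHom.coe_toHomUnits, Matrix.permMatrixHom_apply]⟩

/-- Every permutation matrix is an element of `permSubst`. -/
theorem permMatrix_mem_permSubst (P : Equiv.Perm σ) :
    ∃ γ ∈ permSubst σ k, (γ : Matrix σ σ k) = P.permMatrix k :=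
  ⟨(Matrix.permMatrixHom (n := σ) (R := k)).toHomUnits P⁻¹, ⟨P⁻¹, rfl⟩,
    by rw [MonoidHom.coe_toHomUnits, Matrix.permMatrixHom_apply, inv_inv]⟩

/-- The toy width of `e_m` in degree `d ≤ m` is at most `m(d+1)+1`. -/
theorem idealWidth_toy_le {m d : ℕ} (hd : d ≤ m) :
    idealWidth (permSubst (Fin m) ℂ) (∏ i : Fin m, X i : MvPolynomial (Fin m) ℂ) d ≤ m * (d + 1) + 1 := by
  simpa using idealWidth_prod_X_le (permSubst (Fin m) ℂ)
    (fun γ hγ => exists_permMatrix_of_mem_permSubst hγ) (d := d) (by simpa using hd)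

/-- A uniform polynomial bound, in the shape of `idealWidth_le_of_polyLayered`: the toy width of `e_m` is
`≤ m³ + 3` at every cut `d ≤ m`. -/
theorem idealWidth_toy_polyBound :
    ∃ c : ℕ, ∀ m d : ℕ, d ≤ m →
      idealWidth (permSubst (Fin m) ℂ) (∏ i : Fin m, X i : MvPolynomial (Fin m) ℂ) d ≤ m ^ c + c := by
  refine ⟨3, fun m d hd => (idealWidth_toy_le hd).trans ?_⟩
  have hdm : m * (d + 1) ≤ m * (m + 1) := Nat.mul_le_mul_left m (Nat.succ_le_succ hd)
  rcases Nat.lt_or_ge m 2 with hm | hm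
  · interval_cases m <;> omega
  · have hmm : m + 1 ≤ m * m := by nlinarith
    calc m * (d + 1) + 1 ≤ m * (m + 1) + 1 := Nat.add_le_add_right hdm 1
      _ ≤ m * (m * m) + 1 := Nat.add_le_add_right (Nat.mul_le_mul_left m hmm) 1
      _ = m ^ 3 + 1 := by ring
      _ ≤ m ^ 3 + 3 := by omega

/-- **The diagonal shadow of `R^lay` is false**: the toy analogue of `IdealWidthSuperpoly` —
superpolynomial growth of the `𝔖_m`-equivariant ideal width of `e_m = X₁ ⋯ X_m` at some cuts `d ≤ m` —
fails, by the uniform bound `idealWidth_toy_polyBound`. -/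
theorem not_toyIdealWidthSuperpoly :
    ¬ (∀ c : ℕ, ∃ m d : ℕ, d ≤ m ∧
        m ^ c + c < idealWidth (permSubst (Fin m) ℂ) (∏ i : Fin m, X i : MvPolynomial (Fin m) ℂ) d) := by
  intro h
  obtain ⟨c, hc⟩ := idealWidth_toy_polyBound
  obtain ⟨m, d, hd, hlt⟩ := h c
  exact absurd (hc m d hd) (not_le.2 hlt)

end

end Summit.ValiantsHypothesis.ValiantsHypothesis.Theorems.EquivariantDialLayersToy
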